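import Literature.MathematicalPhysics.QuantumFieldTheory.Balaban1983to89.T3FinestHeightTail
import Literature.MathematicalPhysics.QuantumFieldTheory.Balaban1983to89.T4AxialGaugeSmallField
import HarnessLib

/-!
# Level-0 Peierls for `gibbsK` on a non-wrapping box at the canonical scale `θ_K = β_K^{−3∕8}`, POLYNOMIAL form —
# the SHAPE of LINE 28 «GrossTransfer» skeleton v1's `stub_peierls0` (crux `HistoryTailL`, stmt-QuantumFields-19936)

Cell `ym3-torus` (YM ladder rung R3 = continuum SU(2) Yang–Mills on T³ — a RUNG, NOT the Clay problem); WIDTH helper seat `ym3-torus-px8` g9.  Helper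
`--supports stmt-QuantumFields-19936`; THEOREMS ONLY (0 `def`, 0 `sorry`, default heartbeats).  The per-plaquette Peierls–chessboard bound is the tree's
lit ✓`T3FinestHeightTail.gibbsMeasure_real_dist1_ge_le` (ym3-torus-lit g8; used BY NAME — the box∕θBal-scale repackaging ✓`UnitScaleGibbsBoxLargeFieldTail` of
ym3-torus-px3 g10 is its sibling at Bałaban's threshold).

WHAT (ideator ym-r3-idea-2 g16, skeleton v1 `line-gross_transfer.v1.lean` c904a77abbc2fd15, stub `stub_peierls0`, R-128 compliant polynomial form).  For every block size
`L` and every moment order `M` there are `C ≥ 0` and `γ₁ ∈ (0,1]` (`γ₁ = 1`) such that for every family `F` with `F.L = L`, every `0 < γ ≤ γ₁`, every cutoff `K`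
and every NON-WRAPPING box `[lo, hi]` of side `≤ n` (`n < sitesPerDir 0`):
  `μ_K{¬ (every plaquette of boxPlaqs lo hi is θ_K-small)} ≤ C·(n+1)³·(γL^{−K})^M`,   `θ_K = (γL^{−K})^{3∕8} = β_K^{−3∕8}`   (★★★ `stub_peierls0_shape`).
PROOF.  §1 the one real-analysis letter `s^m·e^{−s∕4} ≤ 4^m·m!` (`Real.pow_div_factorial_le_exp`) and its scale form at `x = γL^{−K} = β_K⁻¹`:
`x^{−9∕2}·exp(−x^{−1∕4}∕4) ≤ 4^m m!·x^M`, `m = 4M + 18` (`(√β_K)^9 = x^{−9∕2}`, `β_Kθ_K² = x^{−1∕4}`); §2 the count `#boxPlaqs lo hi ≤ 3·(n+1)³` (inject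
`p ↦ (z(p), (μ,ν))` into `Finset.Icc lo hi × {μ < ν}`, `Pi.card_Icc`); §3 the union bound over the box with lit's per-plaquette
`μ_K{θ ≤ dist₁(U(∂p))} ≤ 2e^{24}c⁻³(√β_K)^9 e^{−β_Kθ²∕4}` (every `θ ≥ 0`, `β_K ≥ 1`); §4 the assembly at `θ = θ_K`, `β_K = x⁻¹ ≥ 1` for `γ ≤ 1`.
HONEST SCOPE.  Level 0 only (the event constrains the bare field on the box); nothing of `stub_linTest` ∕ `stub_condSD` ∕ `stub_hessOnEvent` ∕ the LINE ∕
«ShallowFluxSecondMomentL» ∕ (Q) ∕ K1 ∕ `MeanDeviationL` ∕ `HistoryTailL` ∕ any crux or rung statement is proved; the skeleton is not yet a registered line (its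
stub, when registered with this text, closes by `exact stub_peierls0_shape`).  YM₃ on T³ is rung R3 — NOT d = 4, NOT infinite volume, NOT a mass gap, NOT Clay;
YM gap NOT proved.

References: T. Bałaban, CMP 102 (1985) 255–275 [Balaban1985UV3] ((71) p.273, the large-field factors `e^{−p(g)²∕4}`); J. Fröhlich, R. Israel, E. Lieb, B. Simon,
CMP 62 (1978) 1–34 [FrohlichIsraelLiebSimon1978] (§4, chessboard estimates).
-/

set_option autoImplicit false

noncomputable section

open scoped BigOperators
open MeasureTheory Finset
open Literature.MathematicalPhysics.QuantumFieldTheory.Balaban1983to89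
open Literature.MathematicalPhysics.QuantumFieldTheory.Balaban1983to89.T3ContinuumYM3Torus
open Literature.MathematicalPhysics.QuantumFieldTheory.Balaban1983to89.T3UnitScaleTilt
open Literature.MathematicalPhysics.QuantumFieldTheory.Balaban1983to89.T3UnitLawDensityEML (ℰp)
open Literature.MathematicalPhysics.QuantumFieldTheory.Balaban1983to89.T4AxialGaugeSmallField (boxPlaqs castSite)
open Literature.MathematicalPhysics.QuantumFieldTheory.Balaban1983to89.B7Prop1Explicit (e e_apply)
open Literature.MathematicalPhysics.QuantumFieldTheory.Balaban1983to89.T3FinestHeightTail (gibbsMeasure_real_dist1_ge_le)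

namespace Summit.QuantumFields.YangMills.Theorems.UnitScaleGibbsBoxPeierlsPolynomial

/-! ## §1 The real-analysis letter: `s^m e^{−s∕4} ≤ 4^m m!` and its scale form -/

/-- `s^m·exp(−s∕4) ≤ 4^m·m!` for `s ≥ 0` (from `(s∕4)^m∕m! ≤ exp(s∕4)`). [folklore] -/
theorem pow_mul_exp_neg_quarter_le (m : ℕ) {s : ℝ} (hs : 0 ≤ s) :
    s ^ m * Real.exp (-(s / 4)) ≤ (4 : ℝ) ^ m * (m.factorial : ℝ) := by
  have h := Real.pow_div_factorial_le_exp (s / 4) (by positivity) m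
  have hfac : (0 : ℝ) < m.factorial := by exact_mod_cast Nat.factorial_pos m
  rw [div_le_iff₀ hfac, div_pow] at h
  -- `h : s^m / 4^m ≤ exp (s/4) * m!`
  rw [div_le_iff₀ (by positivity)] at h
  have hexp : 0 < Real.exp (s / 4) := Real.exp_pos _
  calc s ^ m * Real.exp (-(s / 4)) = s ^ m / Real.exp (s / 4) := by rw [Real.exp_neg]; rfl
    _ ≤ Real.exp (s / 4) * (m.factorial : ℝ) * 4 ^ m / Real.exp (s / 4) := by gcongr
    _ = (4 : ℝ) ^ m * (m.factorial : ℝ) := by field_simp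

/-- ★ THE SCALE LETTER at `x = γL^{−K} = β_K⁻¹`: `x^{−9∕2}·exp(−x^{−1∕4}∕4) ≤ 4^{4M+18}·(4M+18)!·x^M` for `x > 0` (`s := x^{−1∕4}`:
`x^{−9∕2} = s^{18}`, `x^M = s^{−4M}`). [folklore] -/
theorem rpow_mul_exp_le_pow (M : ℕ) {x : ℝ} (hx : 0 < x) :
    x ^ (-(9 / 2 : ℝ)) * Real.exp (-(x ^ (-(1 / 4 : ℝ)) / 4)) ≤
      (4 : ℝ) ^ (4 * M + 18) * ((4 * M + 18).factorial : ℝ) * x ^ M := by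
  set s : ℝ := x ^ (-(1 / 4 : ℝ)) with hs
  have hs0 : 0 < s := Real.rpow_pos_of_pos hx _
  have h18 : x ^ (-(9 / 2 : ℝ)) = s ^ 18 := by
    rw [hs, ← Real.rpow_natCast, ← Real.rpow_mul hx.le]; norm_num
  have hM : s ^ (4 * M) * x ^ M = 1 := by
    rw [hs, ← Real.rpow_natCast, ← Real.rpow_mul hx.le, ← Real.rpow_natCast x M, ← Real.rpow_add hx]
    have : -(1 / 4 : ℝ) * ((4 * M : ℕ) : ℝ) + (M : ℝ) = 0 := by push_cast; ring
    rw [this, Real.rpow_zero]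
  have key := pow_mul_exp_neg_quarter_le (4 * M + 18) hs0.le
  have hxM : 0 < x ^ M := pow_pos hx M
  calc x ^ (-(9 / 2 : ℝ)) * Real.exp (-(s / 4))
      = (s ^ (4 * M + 18) * Real.exp (-(s / 4))) * x ^ M := by
        rw [h18, pow_add, show s ^ (4 * M) * s ^ 18 * Real.exp (-(s / 4)) * x ^ M =
          (s ^ (4 * M) * x ^ M) * (s ^ 18 * Real.exp (-(s / 4))) by ring, hM, one_mul]
    _ ≤ ((4 : ℝ) ^ (4 * M + 18) * ((4 * M + 18).factorial : ℝ)) * x ^ M :=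
        mul_le_mul_of_nonneg_right key hxM.le

/-! ## §2 Counting the plaquettes of a box: `#boxPlaqs lo hi ≤ 3·(n+1)³` -/

section Count

variable (F : T3Family) (K : ℕ)

open Classical in
/-- ★ **`#boxPlaqs lo hi ≤ 3·(n+1)³`** for a box of side `≤ n` in the finest torus of the member `F.P K` (`d = 3`): a plaquette of the box is
determined by its integer base point `z ∈ [lo, hi]` and its plane `μ < ν`. [folklore] -/
theorem card_filter_mem_boxPlaqs_le (lo hi : Fin (F.P K).d → ℤ) (n : ℕ) (hbox : ∀ κ, lo κ ≤ hi κ ∧ hi κ ≤ lo κ + n) :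
    ((Finset.univ.filter fun p : Plaq (F.P K) 0 => p ∈ boxPlaqs lo hi).card : ℝ) ≤ 3 * ((n : ℝ) + 1) ^ 3 := by
  -- choose the integer base point of each box plaquette
  have hmem : ∀ p ∈ Finset.univ.filter (fun p : Plaq (F.P K) 0 => p ∈ boxPlaqs lo hi),
      ∃ z : Fin (F.P K).d → ℤ, lo ≤ z ∧ z + e p.μ + e p.ν ≤ hi ∧ p.src = castSite z := fun p hp => (Finset.mem_filter.1 hp).2
  choose! z hz using hmem
  -- the target: integer points of the box times the three planes
  set T : Finset ((Fin (F.P K).d → ℤ) × {q : Fin (F.P K).d × Fin (F.P K).d // q.1 < q.2}) :=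
    Finset.Icc lo hi ×ˢ Finset.univ with hT
  have hmaps : Set.MapsTo (fun p : Plaq (F.P K) 0 => (z p, (⟨(p.μ, p.ν), p.hμν⟩ : {q : Fin (F.P K).d × Fin (F.P K).d // q.1 < q.2})))
      (Finset.univ.filter fun p : Plaq (F.P K) 0 => p ∈ boxPlaqs lo hi) T := by
    intro p hp
    obtain ⟨hlo, hhi, -⟩ := hz p hp
    simp only [hT, Finset.coe_product, Finset.coe_univ, Set.mem_prod, Finset.mem_coe, Finset.mem_Icc, Set.mem_univ, and_true]
    refine ⟨hlo, fun κ => ?_⟩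
    have h := hhi κ
    simp only [Pi.add_apply, e_apply] at h
    split_ifs at h <;> linarith
  have hinj : Set.InjOn (fun p : Plaq (F.P K) 0 => (z p, (⟨(p.μ, p.ν), p.hμν⟩ : {q : Fin (F.P K).d × Fin (F.P K).d // q.1 < q.2})))
      (Finset.univ.filter fun p : Plaq (F.P K) 0 => p ∈ boxPlaqs lo hi) := by
    intro p hp p' hp' h
    have h1 : z p = z p' := congrArg Prod.fst h
    have h2 := congrArg Subtype.val (congrArg Prod.snd h)
    have hμ : p.μ = p'.μ := congrArg Prod.fst h2
    have hν : p.ν = p'.ν := congrArg Prod.snd h2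
    obtain ⟨-, -, hs⟩ := hz p hp
    obtain ⟨-, -, hs'⟩ := hz p' hp'
    have hsrc : p.src = p'.src := by rw [hs, hs', h1]
    cases p; cases p'
    simp only at hsrc hμ hν
    subst hsrc hμ hν
    rfl
  have hcard := Finset.card_le_card_of_injOn _ hmaps hinj
  -- `#T = #Icc lo hi · 3 ≤ (n+1)³ · 3`
  have hpairs : Fintype.card {q : Fin (F.P K).d × Fin (F.P K).d // q.1 < q.2} = 3 := by
    rw [show (F.P K).d = 3 from rfl]; decide
  have hIcc : (Finset.Icc lo hi).card ≤ (n + 1) ^ 3 := by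
    rw [Pi.card_Icc]
    calc ∏ κ, (Finset.Icc (lo κ) (hi κ)).card ≤ ∏ _κ : Fin (F.P K).d, (n + 1) := by
          refine Finset.prod_le_prod' fun κ _ => ?_
          rw [Int.card_Icc]
          have h := hbox κ
          omega
      _ = (n + 1) ^ 3 := by rw [Finset.prod_const, Finset.card_univ, show (F.P K).d = 3 from rfl, Fintype.card_fin]
  have hTcard : T.card ≤ (n + 1) ^ 3 * 3 := by
    rw [hT, Finset.card_product, Finset.card_univ, hpairs]
    exact Nat.mul_le_mul_right 3 hIcc
  have h := hcard.trans hTcard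
  calc ((Finset.univ.filter fun p : Plaq (F.P K) 0 => p ∈ boxPlaqs lo hi).card : ℝ) ≤ (((n + 1) ^ 3 * 3 : ℕ) : ℝ) := by
        exact_mod_cast h
    _ = 3 * ((n : ℝ) + 1) ^ 3 := by push_cast; ring

end Count

/-! ## §3 The union bound over the box with the per-plaquette Peierls estimate (every threshold `θ ≥ 0`, `β_K ≥ 1`) -/

/-- ★★ **BOX LARGE-FIELD TAIL AT ANY THRESHOLD**: for `γ > 0`, `β_K ≥ 1`, `θ ≥ 0` and a box of side `≤ n`,
`μ_K{¬ (boxPlaqs lo hi is θ-small)} ≤ 3(n+1)³ · 2e^{24}c⁻³·(√β_K)^9·exp(−β_Kθ²∕4)` — union bound + lit ✓`gibbsMeasure_real_dist1_ge_le` (`d = 3`, `N = 2`).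
[cite: FrohlichIsraelLiebSimon1978, §4; Balaban1985UV3, (71) p.273] -/
theorem gibbsK_real_not_plaqSmallOn_boxPlaqs_le :
    ∃ c : ℝ, 0 < c ∧ c ≤ 1 ∧ ∀ (F : T3Family) (γ : ℝ), 0 < γ → ∀ (K : ℕ), 1 ≤ (F.scheme ℰp γ).β K →
      ∀ (lo hi : Fin (F.P K).d → ℤ) (n : ℕ), (∀ κ, lo κ ≤ hi κ ∧ hi κ ≤ lo κ + n) → ∀ (θ : ℝ), 0 ≤ θ →
        (gibbsK F ℰp γ K).real {U | ¬ PlaqSmallOn (boxPlaqs lo hi) θ U} ≤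
          3 * ((n : ℝ) + 1) ^ 3 * (2 * Real.exp 24 * (c ^ 3)⁻¹ * Real.sqrt ((F.scheme ℰp γ).β K) ^ 9 *
            Real.exp (-((F.scheme ℰp γ).β K * θ ^ 2 / 4))) := by
  classical
  obtain ⟨c, hc, hc1, h⟩ := gibbsMeasure_real_dist1_ge_le (N := 2)
  refine ⟨c, hc, hc1, fun F γ hγ K hβ lo hi n hbox θ hθ => ?_⟩
  haveI := isProbabilityMeasure_gibbsK F ℰp hγ.le K
  set S := Finset.univ.filter fun p : Plaq (F.P K) 0 => p ∈ boxPlaqs lo hi with hS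
  set B : ℝ := 2 * Real.exp 24 * (c ^ 3)⁻¹ * Real.sqrt ((F.scheme ℰp γ).β K) ^ 9 *
    Real.exp (-((F.scheme ℰp γ).β K * θ ^ 2 / 4)) with hB
  -- the per-plaquette bound, read at `gibbsK = gibbsMeasure (F.P K) β_K`, `d = 3`, `N = 2`
  have hp1 : ∀ p : Plaq (F.P K) 0, (gibbsK F ℰp γ K).real {U | θ ≤ dist1 (GaugeField.plaqHol U p)} ≤ B := by
    intro p
    have h1 := h (F.P K) ((F.scheme ℰp γ).β K) hβ θ hθ p
    have hcard2 : Fintype.card {q : Fin (F.P K).d × Fin (F.P K).d // q.1 < q.2} = 3 := by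
      rw [show (F.P K).d = 3 from rfl]; decide
    rw [gibbsK_eq]
    refine h1.trans (le_of_eq ?_)
    rw [hcard2, show (F.P K).d = 3 from rfl, hB]
    norm_num
  -- the bad event is the union over the box plaquettes
  have hsub : {U : GaugeField (F.P K) 0 (Matrix.specialUnitaryGroup (Fin 2) ℂ) | ¬ PlaqSmallOn (boxPlaqs lo hi) θ U} ⊆
      ⋃ p ∈ S, {U | θ ≤ dist1 (GaugeField.plaqHol U p)} := by
    intro U hU
    simp only [Set.mem_setOf_eq, PlaqSmallOn, not_forall, not_lt] at hU
    obtain ⟨p, hp, hpU⟩ := hU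
    simp only [Set.mem_iUnion, Set.mem_setOf_eq]
    exact ⟨p, Finset.mem_filter.2 ⟨Finset.mem_univ _, hp⟩, hpU⟩
  have hB0 : 0 ≤ B := by rw [hB]; positivity
  calc (gibbsK F ℰp γ K).real {U | ¬ PlaqSmallOn (boxPlaqs lo hi) θ U}
      ≤ (gibbsK F ℰp γ K).real (⋃ p ∈ S, {U | θ ≤ dist1 (GaugeField.plaqHol U p)}) :=
        measureReal_mono hsub (measure_ne_top _ _)
    _ ≤ ∑ p ∈ S, (gibbsK F ℰp γ K).real {U | θ ≤ dist1 (GaugeField.plaqHol U p)} := measureReal_biUnion_finset_le _ _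
    _ ≤ ∑ _p ∈ S, B := Finset.sum_le_sum fun p _ => hp1 p
    _ = (S.card : ℝ) * B := by rw [Finset.sum_const, nsmul_eq_mul]
    _ ≤ 3 * ((n : ℝ) + 1) ^ 3 * B := mul_le_mul_of_nonneg_right (card_filter_mem_boxPlaqs_le F K lo hi n hbox) hB0

/-! ## §4 The canonical scale `θ_K = (γL^{−K})^{3∕8}`: the stub shape -/

/-- ★★★ **`stub_peierls0` OF LINE 28 SKELETON v1, AS TYPED** (ideator ym-r3-idea-2 g16 `line-gross_transfer.v1.lean` c904a77abbc2fd15): for every `L`, `M` there are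
`C ≥ 0` and `γ₁ ∈ (0,1]` with `μ_K{¬ PlaqSmallOn (boxPlaqs lo hi) (γL^{−K})^{3∕8}} ≤ C·(n+1)³·(γL^{−K})^M` for every family `F` (`F.L = L`), every `0 < γ ≤ γ₁`, every
`K` and every non-wrapping box of side `≤ n`.  Witnesses: `γ₁ = 1`, `C = 3·2e^{24}c⁻³·4^{4M+18}(4M+18)!`.  Proof: §3 at `θ = θ_K`, `β_K = (γL^{−K})⁻¹ ≥ 1`, and §1.
[cite: Balaban1985UV3, (1)-(3) p.256 and (71) p.273; FrohlichIsraelLiebSimon1978, §4] -/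
theorem stub_peierls0_shape :
    ∀ (L M : ℕ), ∃ C : ℝ, 0 ≤ C ∧ ∃ γ₁ : ℝ, 0 < γ₁ ∧ γ₁ ≤ 1 ∧
        ∀ (F : T3Family) (γ : ℝ), F.L = L → 0 < γ → γ ≤ γ₁ → ∀ (K : ℕ) (lo hi : Fin (F.P K).d → ℤ) (n : ℕ),
          (∀ κ, lo κ ≤ hi κ ∧ hi κ ≤ lo κ + n) → n < (F.P K).sitesPerDir 0 →
          (gibbsK F ℰp γ K).real {U | ¬ PlaqSmallOn (boxPlaqs lo hi) ((γ * ((L : ℝ)⁻¹) ^ K) ^ ((3 : ℝ) / 8)) U}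
            ≤ C * ((n : ℝ) + 1) ^ 3 * (γ * ((L : ℝ)⁻¹) ^ K) ^ M := by
  intro L M
  obtain ⟨c, hc, -, h⟩ := gibbsK_real_not_plaqSmallOn_boxPlaqs_le
  refine ⟨3 * (2 * Real.exp 24 * (c ^ 3)⁻¹) * ((4 : ℝ) ^ (4 * M + 18) * ((4 * M + 18).factorial : ℝ)),
    by positivity, 1, one_pos, le_rfl, fun F γ hFL hγ hγ1 K lo hi n hbox _ => ?_⟩
  -- the scale `x = γ·L^{−K} = β_K⁻¹ ∈ (0, 1]`
  have hL1 : (1 : ℝ) < (L : ℝ) := by rw [← hFL]; exact_mod_cast F.hL.2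
  have hL0 : (0 : ℝ) < (L : ℝ) := lt_trans zero_lt_one hL1
  set x : ℝ := γ * ((L : ℝ)⁻¹) ^ K with hxdef
  have hx : 0 < x := mul_pos hγ (pow_pos (inv_pos.2 hL0) K)
  have hx1 : x ≤ 1 := by
    have h1 : ((L : ℝ)⁻¹) ^ K ≤ 1 := pow_le_one₀ (inv_nonneg.2 hL0.le) (inv_le_one_of_one_le₀ hL1.le)
    calc x = γ * ((L : ℝ)⁻¹) ^ K := rfl
      _ ≤ 1 * 1 := mul_le_mul hγ1 h1 (pow_nonneg (inv_nonneg.2 hL0.le) K) zero_le_one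
      _ = 1 := one_mul _
  have hβx : (F.scheme ℰp γ).β K = x⁻¹ := by
    show (γ * (F.P K).eps)⁻¹ = x⁻¹
    have heps : (F.P K).eps = ((F.L : ℝ)⁻¹) ^ K := rfl
    rw [heps, hFL]
  have hβ1 : 1 ≤ (F.scheme ℰp γ).β K := by rw [hβx]; exact (one_le_inv₀ hx).2 hx1
  -- §3 at `θ = θ_K`
  have hθ : 0 ≤ x ^ ((3 : ℝ) / 8) := Real.rpow_nonneg hx.le _
  have h3 := h F γ hγ K hβ1 lo hi n hbox (x ^ ((3 : ℝ) / 8)) hθ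
  -- the scale identities `(√β_K)^9 = x^{−9∕2}`, `β_K·θ_K² = x^{−1∕4}`
  have hsqrt : Real.sqrt ((F.scheme ℰp γ).β K) ^ 9 = x ^ (-(9 / 2 : ℝ)) := by
    rw [hβx, Real.sqrt_eq_rpow, Real.inv_rpow hx.le, ← Real.rpow_neg hx.le, ← Real.rpow_natCast,
      ← Real.rpow_mul hx.le]
    norm_num
  have hexp : (F.scheme ℰp γ).β K * (x ^ ((3 : ℝ) / 8)) ^ 2 / 4 = x ^ (-(1 / 4 : ℝ)) / 4 := by
    rw [hβx, ← Real.rpow_neg_one, ← Real.rpow_natCast, ← Real.rpow_mul hx.le, ← Real.rpow_add hx]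
    norm_num
  rw [hsqrt, hexp] at h3
  have h1 := rpow_mul_exp_le_pow M hx
  -- assemble
  have hn : 0 ≤ 3 * ((n : ℝ) + 1) ^ 3 := by positivity
  have hC0 : 0 ≤ 2 * Real.exp 24 * (c ^ 3)⁻¹ := by positivity
  calc (gibbsK F ℰp γ K).real {U | ¬ PlaqSmallOn (boxPlaqs lo hi) (x ^ ((3 : ℝ) / 8)) U}
      ≤ 3 * ((n : ℝ) + 1) ^ 3 * (2 * Real.exp 24 * (c ^ 3)⁻¹ * x ^ (-(9 / 2 : ℝ)) * Real.exp (-(x ^ (-(1 / 4 : ℝ)) / 4))) := h3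
    _ = 3 * ((n : ℝ) + 1) ^ 3 * (2 * Real.exp 24 * (c ^ 3)⁻¹) * (x ^ (-(9 / 2 : ℝ)) * Real.exp (-(x ^ (-(1 / 4 : ℝ)) / 4))) := by ring
    _ ≤ 3 * ((n : ℝ) + 1) ^ 3 * (2 * Real.exp 24 * (c ^ 3)⁻¹) * ((4 : ℝ) ^ (4 * M + 18) * ((4 * M + 18).factorial : ℝ) * x ^ M) :=
        mul_le_mul_of_nonneg_left h1 (mul_nonneg hn hC0)
    _ = 3 * (2 * Real.exp 24 * (c ^ 3)⁻¹) * ((4 : ℝ) ^ (4 * M + 18) * ((4 * M + 18).factorial : ℝ)) * ((n : ℝ) + 1) ^ 3 * x ^ M := by ring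

/-! ## §5 The registered stub (LINE 28 «GrossTransfer», skeleton `Cruxes/HistoryTailL/Lines/gross_transfer.lean` 5d16c6d7… on item stmt-QuantumFields-23083; ★★OWNER RECORD 17x) -/

/-- ★★★ **REGISTERED STUB `stub_peierls0` OF LINE 28 «GrossTransfer» (item stmt-QuantumFields-23083, `RevelationMartingale.MeanDeviationL`), VERBATIM** (378 chars; owner's
`check_stub.py` MATCH) — closed by §4 BY NAME.  One of the line's five registered stubs; the other four (`stub_linTest`, `stub_condSD`, `stub_hessOnEvent`,
`stub_meanDeviationDeep`), the window second moment, 23133 ∕ 23134 ∕ 23083, K1 and `HistoryTailL` stay OPEN. [cite: Balaban1985UV3, (71) p.273; FrohlichIsraelLiebSimon1978, §4] -/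
theorem stub_peierls0 :
    ∀ (L M : ℕ), ∃ C : ℝ, 0 ≤ C ∧ ∃ γ₁ : ℝ, 0 < γ₁ ∧ γ₁ ≤ 1 ∧ ∀ (F : T3Family) (γ : ℝ), F.L = L → 0 < γ → γ ≤ γ₁ → ∀ (K : ℕ) (lo hi : Fin (F.P K).d → ℤ) (n : ℕ), (∀ κ, lo κ ≤ hi κ ∧ hi κ ≤ lo κ + n) → n < (F.P K).sitesPerDir 0 → (gibbsK F ℰp γ K).real {U | ¬ PlaqSmallOn (boxPlaqs lo hi) ((γ * ((L : ℝ)⁻¹) ^ K) ^ ((3 : ℝ) / 8)) U} ≤ C * ((n : ℝ) + 1) ^ 3 * (γ * ((L : ℝ)⁻¹) ^ K) ^ M :=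
  stub_peierls0_shape

end Summit.QuantumFields.YangMills.Theorems.UnitScaleGibbsBoxPeierlsPolynomial

end
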